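import Mathlib
import Literature.NumberTheory.GaloisRepresentations.ContinuousRep
import Summits.Langlands.Langlands.Theorems.PhantomRMYoshidaStableYoshidaCongruenceResidualLatticeFrame
import HarnessLib

/-!
# Route `PhantomRMYoshida`, crux `StableYoshidaCongruence` (stmt-Langlands-13640), line
# `burkhardt-weddle-two-three-anchor`: flag-shape algebra for Stub 4 `stub_residualLattice`

Helper for the lead's stub `stub_residualLattice` (clauses (M2)–(M4)): the `4 × 4` identity
`conj_flag_shape` (conjugating an upper triangular matrix by an invertible matrix adapted to the flag
`⟨e₀⟩ ⊂ ⟨e₀, e₁⟩` keeps the flag and the two top diagonal entries), the flag shape of the inverse of an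
adapted invertible matrix over a field (`inv_flag_shape`), and two generalities (a homomorphism with open
kernel is continuous; conjugation does not change characteristic polynomials).  Everything is proved;
Mathlib + the tree's `FramedRep`.
-/

set_option linter.dupNamespace false

noncomputable section

open Literature.NumberTheory.GaloisRepresentations Matrix

namespace Summit.Langlands.Langlands.Cruxes.StableYoshidaCongruence.BurkhardtWeddleTwoThreeAnchor

/-! ## A `4 × 4` identity: conjugating a flag-preserving matrix by an adapted change of basis -/

section FlagAlgebra

/-- `Y R Z` for `4 × 4` matrices with `Y Z = 1`, `Y, Z` preserving the flag `⟨e₀⟩ ⊂ ⟨e₀, e₁⟩` (entries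
`(i,0)`, `i ≠ 0`, and `(i,1)`, `i ≥ 2`, vanish) and `R` upper triangular: the product preserves the flag and
has the same top diagonal entries `R₀₀`, `R₁₁`; if moreover `R₀₁ = 0` and `R₀₀ = R₁₁` then its `(0,1)` entry
vanishes. [folklore] -/
theorem conj_flag_shape :
    ∀ {A : Type} [CommRing A] (Y R Z : Matrix (Fin 4) (Fin 4) A), Y * Z = 1 →
      (∀ i : Fin 4, i ≠ 0 → Y i 0 = 0) → (∀ i : Fin 4, 2 ≤ (i : ℕ) → Y i 1 = 0) →
      (∀ i : Fin 4, i ≠ 0 → Z i 0 = 0) → (∀ i : Fin 4, 2 ≤ (i : ℕ) → Z i 1 = 0) →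
      (∀ i j : Fin 4, j < i → R i j = 0) →
      (∀ i : Fin 4, i ≠ 0 → (Y * R * Z) i 0 = 0) ∧ (∀ i : Fin 4, 2 ≤ (i : ℕ) → (Y * R * Z) i 1 = 0) ∧
        (Y * R * Z) 0 0 = R 0 0 ∧ (Y * R * Z) 1 1 = R 1 1 ∧
        (R 0 1 = 0 → R 0 0 = R 1 1 → (Y * R * Z) 0 1 = 0) := by
  intro A _ Y R Z hYZ hY0 hY1 hZ0 hZ1 hR
  have hY10 : Y 1 0 = 0 := hY0 1 (by decide)
  have hY20 : Y 2 0 = 0 := hY0 2 (by decide)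
  have hY30 : Y 3 0 = 0 := hY0 3 (by decide)
  have hY21 : Y 2 1 = 0 := hY1 2 (by decide)
  have hY31 : Y 3 1 = 0 := hY1 3 (by decide)
  have hZ10 : Z 1 0 = 0 := hZ0 1 (by decide)
  have hZ20 : Z 2 0 = 0 := hZ0 2 (by decide)
  have hZ30 : Z 3 0 = 0 := hZ0 3 (by decide)
  have hZ21 : Z 2 1 = 0 := hZ1 2 (by decide)
  have hZ31 : Z 3 1 = 0 := hZ1 3 (by decide)
  have hR10 : R 1 0 = 0 := hR 1 0 (by decide)
  have hR20 : R 2 0 = 0 := hR 2 0 (by decide)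
  have hR30 : R 3 0 = 0 := hR 3 0 (by decide)
  have hR21 : R 2 1 = 0 := hR 2 1 (by decide)
  have hR31 : R 3 1 = 0 := hR 3 1 (by decide)
  have hR32 : R 3 2 = 0 := hR 3 2 (by decide)
  have h00 : Y 0 0 * Z 0 0 = 1 := by
    have h := congrFun (congrFun hYZ 0) 0
    simp only [mul_apply, Fin.sum_univ_four, one_apply_eq] at h
    rw [hZ10, hZ20, hZ30] at h
    linear_combination h
  have h11 : Y 1 1 * Z 1 1 = 1 := by
    have h := congrFun (congrFun hYZ 1) 1
    simp only [mul_apply, Fin.sum_univ_four, one_apply_eq] at h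
    rw [hY10, hZ21, hZ31] at h
    linear_combination h
  have h01 : Y 0 0 * Z 0 1 + Y 0 1 * Z 1 1 = 0 := by
    have h := congrFun (congrFun hYZ 0) 1
    simp only [mul_apply, Fin.sum_univ_four, one_apply_ne (show (0 : Fin 4) ≠ 1 by decide)] at h
    rw [hZ21, hZ31] at h
    linear_combination h
  refine ⟨fun i hi => ?_, fun i hi => ?_, ?_, ?_, fun hR01 hRdiag => ?_⟩
  · have hYi0 : Y i 0 = 0 := hY0 i hi
    simp only [mul_apply, Fin.sum_univ_four, hZ10, hZ20, hZ30, hR10, hR20, hR30, hYi0]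
    ring
  · have hYi0 : Y i 0 = 0 := hY0 i (by intro h; subst h; simp at hi)
    have hYi1 : Y i 1 = 0 := hY1 i hi
    simp only [mul_apply, Fin.sum_univ_four, hZ21, hZ31, hR10, hR20, hR30, hR21, hR31, hYi0, hYi1]
    ring
  · simp only [mul_apply, Fin.sum_univ_four, hZ10, hZ20, hZ30, hR10, hR20, hR30]
    linear_combination R 0 0 * h00
  · simp only [mul_apply, Fin.sum_univ_four, hZ21, hZ31, hR10, hR20, hR30, hR21, hR31, hY10]
    linear_combination R 1 1 * h11
  · simp only [mul_apply, Fin.sum_univ_four, hZ21, hZ31, hR10, hR20, hR30, hR21, hR31, hR01, hRdiag]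
    linear_combination R 1 1 * h01

/-- Over a field, the inverse of an invertible flag-preserving `4 × 4` matrix preserves the flag. [folklore] -/
theorem inv_flag_shape {F : Type*} [Field F] (Q : GL (Fin 4) F)
    (hQ0 : ∀ i : Fin 4, i ≠ 0 → (Q : Matrix (Fin 4) (Fin 4) F) i 0 = 0)
    (hQ1 : ∀ i : Fin 4, 2 ≤ (i : ℕ) → (Q : Matrix (Fin 4) (Fin 4) F) i 1 = 0) :
    (∀ i : Fin 4, i ≠ 0 → ((Q⁻¹ : GL (Fin 4) F) : Matrix (Fin 4) (Fin 4) F) i 0 = 0) ∧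
      (∀ i : Fin 4, 2 ≤ (i : ℕ) → ((Q⁻¹ : GL (Fin 4) F) : Matrix (Fin 4) (Fin 4) F) i 1 = 0) := by
  set Z : Matrix (Fin 4) (Fin 4) F := (Q : Matrix (Fin 4) (Fin 4) F) with hZ
  set Y : Matrix (Fin 4) (Fin 4) F := ((Q⁻¹ : GL (Fin 4) F) : Matrix (Fin 4) (Fin 4) F) with hY
  have hYZ : Y * Z = 1 := by rw [hY, hZ, ← Units.val_mul, inv_mul_cancel, Units.val_one]
  have hZ10 : Z 1 0 = 0 := hQ0 1 (by decide)
  have hZ20 : Z 2 0 = 0 := hQ0 2 (by decide)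
  have hZ30 : Z 3 0 = 0 := hQ0 3 (by decide)
  have hZ21 : Z 2 1 = 0 := hQ1 2 (by decide)
  have hZ31 : Z 3 1 = 0 := hQ1 3 (by decide)
  -- `Z₀₀ ≠ 0`: the first column of `Q` is `Z₀₀ e₀`
  have hZ00 : Z 0 0 ≠ 0 := by
    intro h0
    apply mulVec_single_ne_zero Q 0
    ext i
    rw [mulVec_single_one, hZ.symm]
    change Z i 0 = 0
    fin_cases i
    · exact h0
    · exact hZ10
    · exact hZ20
    · exact hZ30
  -- `Z₁₁ ≠ 0`: else `Q (Z₀₀ e₁ - Z₀₁ e₀) = 0`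
  have hZ11 : Z 1 1 ≠ 0 := by
    intro h1
    have hx : Z *ᵥ (Z 0 0 • Pi.single 1 1 - Z 0 1 • Pi.single 0 1) = 0 := by
      ext i
      simp only [mulVec_sub, mulVec_smul, mulVec_single_one, Pi.sub_apply, Pi.smul_apply, smul_eq_mul,
        Pi.zero_apply]
      change Z 0 0 * Z i 1 - Z 0 1 * Z i 0 = 0
      fin_cases i
      · change Z 0 0 * Z 0 1 - Z 0 1 * Z 0 0 = 0; ring
      · change Z 0 0 * Z 1 1 - Z 0 1 * Z 1 0 = 0; rw [h1, hZ10]; ring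
      · change Z 0 0 * Z 2 1 - Z 0 1 * Z 2 0 = 0; rw [hZ21, hZ20]; ring
      · change Z 0 0 * Z 3 1 - Z 0 1 * Z 3 0 = 0; rw [hZ31, hZ30]; ring
    have hx' : Y *ᵥ (Z *ᵥ (Z 0 0 • Pi.single 1 1 - Z 0 1 • Pi.single 0 1)) =
        Z 0 0 • Pi.single 1 1 - Z 0 1 • Pi.single 0 1 := by
      rw [mulVec_mulVec, hYZ, one_mulVec]
    rw [hx, mulVec_zero] at hx'
    have h := congrFun hx' 1
    simp at h
    exact hZ00 h.symm
  refine ⟨fun i hi => ?_, fun i hi => ?_⟩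
  · have h := congrFun (congrFun hYZ i) 0
    simp only [mul_apply, Fin.sum_univ_four, hZ10, hZ20, hZ30, mul_zero, add_zero,
      one_apply_ne hi] at h
    exact (mul_eq_zero.1 h).resolve_right hZ00
  · have hi0 : i ≠ 0 := by intro h; subst h; simp at hi
    have hi1 : i ≠ 1 := by intro h; subst h; simp at hi
    have h0 := congrFun (congrFun hYZ i) 0
    simp only [mul_apply, Fin.sum_univ_four, hZ10, hZ20, hZ30, mul_zero, add_zero,
      one_apply_ne hi0] at h0
    have hYi0 : Y i 0 = 0 := (mul_eq_zero.1 h0).resolve_right hZ00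
    have h := congrFun (congrFun hYZ i) 1
    simp only [mul_apply, Fin.sum_univ_four, hZ21, hZ31, mul_zero, add_zero, hYi0, zero_mul, zero_add,
      one_apply_ne hi1] at h
    exact (mul_eq_zero.1 h).resolve_right hZ11

end FlagAlgebra

/-! ## Small generalities -/

section General

/-- A homomorphism of topological groups with open kernel is continuous (it is locally constant).
[folklore] -/
theorem continuous_of_isOpen_ker {Γ H : Type*} [Group Γ] [TopologicalSpace Γ] [IsTopologicalGroup Γ]
    [Group H] [TopologicalSpace H] [IsTopologicalGroup H] (f : Γ →* H) (hf : IsOpen (f.ker : Set Γ)) :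
    Continuous f := by
  -- adapted from `Literature/NumberTheory/GaloisRepresentations/GlobalArtinMapOfCharactersProofs.lean`
  refine continuous_of_continuousAt_one f ?_
  rw [ContinuousAt, map_one]
  refine Filter.tendsto_def.mpr fun W hW => Filter.mem_of_superset (hf.mem_nhds f.ker.one_mem) ?_
  intro x hx
  rw [Set.mem_preimage, (MonoidHom.mem_ker).mp hx]
  exact mem_of_mem_nhds hW

/-- Change of frame does not change characteristic polynomials. [folklore] -/
theorem charpoly_conj_eq {A : Type*} [CommRing A] [TopologicalSpace A] [IsTopologicalRing A]
    {G : Type*} [Group G] [TopologicalSpace G] {n : ℕ} (P : GL (Fin n) A) (ρ : FramedRep G A n) (g : G) :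
    (ρ.conj P).charpoly g = ρ.charpoly g := by
  simp only [FramedRep.charpoly, FramedRep.conj_apply, Units.val_mul, Matrix.coe_units_inv]
  exact Matrix.charpoly_units_conj P _

end General

end Summit.Langlands.Langlands.Cruxes.StableYoshidaCongruence.BurkhardtWeddleTwoThreeAnchor

end
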